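import Summits.SmoothPoincare4.SmoothPoincare4.Theorems.SblfDescentRungOneHelperTimelikeCircleDominated
import Summits.SmoothPoincare4.SmoothPoincare4.Theorems.SblfDescentRungOneHelperTimelikeEllipseLoop
import Summits.SmoothPoincare4.SmoothPoincare4.Theorems.SblfDescentRungOneHelperTimelikeConeRetraction
import Mathlib.Analysis.InnerProductSpace.PiL2
import HarnessLib

/-!
# The small spacelike circle of a transverse slice is the core circle of the fold box

Helper layer `helper_timelike_vanishingLoop` of stub `helper_foldNF_timelike` (the
untwistedness of the round `1`-handle; towards the essentiality of the vanishing cycle,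
`helper_timelike_essential`), line `Sketch`, crux `SblfDescent.RungOne`.

(Crux item stmt-SmoothPoincare4-18531; skeleton `Cruxes/RungOne/Lines/Sketch.lean`.)

Abstract form of the comparison between the two natural "vanishing cycles" about a round
point: let `φ` be a chart of `X` with a box `‖φ‖ < δ` in which a subset `S ⊆ X` (the torus
side) reads `{x₁² + x₂² > x₃²}` (`helper_timelike_foldBox`), and `Wsl : ℝ³ → X` a transverse
slice through the centre linearised by the chart, `φ (Wsl x) = D₀ x + o(‖x‖)`.  For a pair
`b₁, b₂` with `D₀ b₁, D₀ b₂` spacelike and orthogonal for `Q = x₁² + x₂² - x₃²`, the small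
circles `θ ↦ Wsl (r (cos 2πθ b₁ + sin 2πθ b₂))` lie in `S` and have, in `H₁(S; ℤ)`, the
Hurewicz class of the core circle `φ⁻¹ (0, ρ cos 2πεθ, ρ sin 2πεθ, 0)` (`ρ = δ/2`) traversed
with a sign `ε = ±1` (`helper_timelike_vanishingLoop`).  The free homotopy inside `S`:
straighten the circle to its linearisation `r D₀ (cos b₁ + sin b₂)` (an ellipse in a spacelike
plane; `Q` stays positive for `r` small), retract the box onto the core circle
(`helper_timelike_coneRetraction`), and turn the projected ellipse into the round circle
(`helper_timelike_ellipseLoop`); free homotopies preserve Hurewicz classes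
(`loopClass_eq_of_freeHomotopy`).

## References

* R. İ. Baykur, S. Kamada, *Classification of broken Lefschetz fibrations with small fiber
  genera*, J. Math. Soc. Japan 67 (2015), §2. [BaykurKamada2015]
* A. Hatcher, *Algebraic Topology* (2002), Thm. 2.10, Thm. 2A.1. [HatcherAT2002]
-/

set_option linter.dupNamespace false
noncomputable section

open scoped Topology RealInnerProductSpace
open Set Function Filter Metric Complex Literature.AlgebraicTopology.SingularHomology

namespace Summit.SmoothPoincare4.SmoothPoincare4.Cruxes.RungOne.Sketch

/-- `‖a • x‖ ≤ ‖x‖` for a real scalar with `|a| ≤ 1`. [folklore] -/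
theorem norm_smul_le_of_abs_le_one {F : Type*} [SeminormedAddCommGroup F] [NormedSpace ℝ F] {a : ℝ}
    (ha : |a| ≤ 1) (x : F) : ‖a • x‖ ≤ ‖x‖ := by
  rw [norm_smul, Real.norm_eq_abs]; exact mul_le_of_le_one_left (norm_nonneg _) ha

/-- **A dependent pair of plane vectors has a unit real combination equal to zero**: if
`det (p, q) = 0` then `cos α · p + sin α · q = 0` for some angle. [folklore] -/
theorem exists_cos_sin_combo_eq_zero {p q : ℂ} (h : p.re * q.im - p.im * q.re = 0) :
    ∃ α : ℝ, (Real.cos α : ℂ) * p + (Real.sin α : ℂ) * q = 0 := by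
  by_cases hp : p = 0
  · exact ⟨0, by simp [hp]⟩
  -- `q = t p` with `t` real
  have hp2 : 0 < p.re ^ 2 + p.im ^ 2 := by
    rcases Complex.ext_iff.not.1 hp |> not_and_or.1 with h | h
    · have : p.re ≠ 0 := by simpa using h
      positivity
    · have : p.im ≠ 0 := by simpa using h
      positivity
  set t : ℝ := (p.re * q.re + p.im * q.im) / (p.re ^ 2 + p.im ^ 2) with ht
  have hq : q = (t : ℂ) * p := by
    apply Complex.ext
    · simp only [mul_re, ofReal_re, ofReal_im, zero_mul, sub_zero]
      rw [ht, div_mul_eq_mul_div, eq_div_iff hp2.ne']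
      linear_combination (-p.im) * h
    · simp only [mul_im, ofReal_re, ofReal_im, zero_mul, add_zero]
      rw [ht, div_mul_eq_mul_div, eq_div_iff hp2.ne']
      linear_combination p.re * h
  -- the unit vector `(t, -1)/√(1 + t²)` as `(cos α, sin α)`
  set z : ℂ := (t : ℂ) - Complex.I with hz
  have hz0 : z ≠ 0 := by
    intro h0; have := congrArg Complex.im h0; simp [hz] at this
  refine ⟨Complex.arg z, ?_⟩
  have hcs : (Real.cos (Complex.arg z) : ℂ) = z.re / ‖z‖ ∧ (Real.sin (Complex.arg z) : ℂ) = z.im / ‖z‖ := by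
    constructor
    · rw [Complex.cos_arg hz0]; push_cast; rfl
    · rw [Complex.sin_arg]; push_cast; rfl
  rw [hcs.1, hcs.2, hq]
  have : (z.re : ℂ) = t := by simp [hz]
  have : (z.im : ℂ) = -1 := by simp [hz]
  field_simp
  rw [‹(z.re : ℂ) = t›, ‹(z.im : ℂ) = -1›]
  ring

set_option maxHeartbeats 800000 in
/-- **The small spacelike circle of a transverse slice is the core circle of the fold box, in
`H₁` of the torus side.**  See the module docstring for the setting; the conclusion gives a sign
`ε = ±1` and `r₀ > 0` such that for `0 < r ≤ r₀` the circle
`θ ↦ Wsl (r (cos 2πθ b₁ + sin 2πθ b₂))` runs in `S`, inside the chart box, and every loop of `S`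
with this parametrisation has the Hurewicz class of every loop of `S` parametrising the core
circle `φ⁻¹ (0, δ/2 cos 2πεθ, δ/2 sin 2πεθ, 0)`. [cite: BaykurKamada2015, §2]
[cite: HatcherAT2002, Thm. 2.10 and Thm. 2A.1] -/
theorem helper_timelike_vanishingLoop : ∀ (X : Type) [TopologicalSpace X] (S : Set X) (φ : OpenPartialHomeomorph X (EuclideanSpace ℝ (Fin 4))) (Wsl : EuclideanSpace ℝ (Fin 3) → X) (D₀ : EuclideanSpace ℝ (Fin 3) →L[ℝ] EuclideanSpace ℝ (Fin 4)) (δ : ℝ), Continuous Wsl → 0 < δ → Metric.ball (0 : EuclideanSpace ℝ (Fin 4)) δ ⊆ φ.target → (∀ p ∈ φ.source, ‖φ p‖ < δ → (p ∈ S ↔ 0 < (φ p) 1 ^ 2 + (φ p) 2 ^ 2 - (φ p) 3 ^ 2)) → (∀ c : ℝ, 0 < c → ∃ η : ℝ, 0 < η ∧ ∀ x : EuclideanSpace ℝ (Fin 3), ‖x‖ < η → Wsl x ∈ φ.source ∧ ‖φ (Wsl x) - D₀ x‖ ≤ c * ‖x‖) → ∀ (b₁ b₂ : EuclideanSpace ℝ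 (Fin 3)), 0 < (D₀ b₁) 1 ^ 2 + (D₀ b₁) 2 ^ 2 - (D₀ b₁) 3 ^ 2 → 0 < (D₀ b₂) 1 ^ 2 + (D₀ b₂) 2 ^ 2 - (D₀ b₂) 3 ^ 2 → (D₀ b₁) 1 * (D₀ b₂) 1 + (D₀ b₁) 2 * (D₀ b₂) 2 - (D₀ b₁) 3 * (D₀ b₂) 3 = 0 → ∃ (ε : ℤ) (r₀ : ℝ), (ε = 1 ∨ ε = -1) ∧ 0 < r₀ ∧ ∀ r : ℝ, 0 < r → r ≤ r₀ → (∀ θ : ℝ, Wsl (r • (Real.cos (2 * Real.pi * θ) • b₁ + Real.sin (2 * Real.pi * θ) • b₂)) ∈ S ∧ Wsl (r • (Real.cos (2 * Real.pi * θ) • b₁ + Real.sin (2 * Real.pi * θ) • b₂)) ∈ φ.source ∧ ‖φ (Wsl (r • (Real.cos (2 * Real.pi * θ) • b₁ + Real.sin (2 * Real.pi * θ) • b₂)))‖ < δ) ∧ ∀ (xβ : ↥S) (β : Path xβ xβ), (∀ τ : unitInterval, ((β τ : ↥S) : X) = Wsl (r • (Real.cos (2 * Real.pi * (τ : ℝ))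 • b₁ + Real.sin (2 * Real.pi * (τ : ℝ)) • b₂))) → ∀ (xc : ↥S) (γc : Path xc xc), (∀ τ : unitInterval, ((γc τ : ↥S) : X) = φ.symm (WithLp.toLp 2 ![0, δ / 2 * Real.cos (2 * Real.pi * ε * (τ : ℝ)), δ / 2 * Real.sin (2 * Real.pi * ε * (τ : ℝ)), 0])) → loopClass ℤ ℤ (1 : ℤ) β = loopClass ℤ ℤ (1 : ℤ) γc := by
  intro X _ S φ Wsl D₀ δ hWsl hδ hball hS hlin b₁ b₂ hb₁ hb₂ hb₁₂
  set Q : EuclideanSpace ℝ (Fin 4) → ℝ := fun p => p 1 ^ 2 + p 2 ^ 2 - p 3 ^ 2 with hQ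
  have hcoord : ∀ (u : EuclideanSpace ℝ (Fin 4)) (i : Fin 4), |u i| ≤ ‖u‖ := fun u i => by
    rw [EuclideanSpace.norm_eq]; refine Real.abs_le_sqrt ?_; rw [Fin.sum_univ_four]
    simp only [Real.norm_eq_abs, sq_abs]
    fin_cases i <;> simp <;> nlinarith [sq_nonneg (u 0), sq_nonneg (u 1), sq_nonneg (u 2), sq_nonneg (u 3)]
  have hQinc : ∀ a e : EuclideanSpace ℝ (Fin 4), |Q (a + e) - Q a| ≤ (6 * ‖a‖ + 3 * ‖e‖) * ‖e‖ := fun a e => by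
    have h1 := hcoord a 1; have h2 := hcoord a 2; have h3 := hcoord a 3
    have k1 := hcoord e 1; have k2 := hcoord e 2; have k3 := hcoord e 3
    have hexp : Q (a + e) - Q a = 2 * (a 1 * e 1 + a 2 * e 2 - a 3 * e 3) + (e 1 ^ 2 + e 2 ^ 2 - e 3 ^ 2) := by
      simp only [hQ, PiLp.add_apply]; ring
    rw [hexp, abs_le]
    have hae : ∀ i : Fin 4, |a i * e i| ≤ ‖a‖ * ‖e‖ := fun i => by
      rw [abs_mul]; exact mul_le_mul (hcoord a i) (hcoord e i) (abs_nonneg _) (norm_nonneg _)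
    have hee : ∀ i : Fin 4, e i ^ 2 ≤ ‖e‖ ^ 2 := fun i => by
      have := hcoord e i; nlinarith [abs_nonneg (e i), sq_abs (e i)]
    have g1 := hae 1; have g2 := hae 2; have g3 := hae 3
    have f1 := hee 1; have f2 := hee 2; have f3 := hee 3
    rw [abs_le] at g1 g2 g3
    constructor <;> nlinarith [norm_nonneg a, norm_nonneg e, sq_nonneg (e 1), sq_nonneg (e 2), sq_nonneg (e 3)]
  set u : ℝ → EuclideanSpace ℝ (Fin 3) := fun θ => Real.cos (2 * Real.pi * θ) • b₁ + Real.sin (2 * Real.pi * θ) • b₂ with hu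
  have huc : Continuous u := by simp only [hu]; fun_prop
  have hu1 : ∀ θ, u (θ + 1) = u θ := fun θ => by
    simp only [hu, mul_add, mul_one, Real.cos_add_two_pi, Real.sin_add_two_pi]
  set Mb : ℝ := ‖b₁‖ + ‖b₂‖ + 1 with hMb
  have hMb0 : 0 < Mb := by positivity
  have hub : ∀ θ, ‖u θ‖ < Mb := fun θ => by
    have h1 := norm_smul_le_of_abs_le_one (Real.abs_cos_le_one (2 * Real.pi * θ)) b₁
    have h2 := norm_smul_le_of_abs_le_one (Real.abs_sin_le_one (2 * Real.pi * θ)) b₂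
    calc ‖u θ‖ ≤ ‖Real.cos (2 * Real.pi * θ) • b₁‖ + ‖Real.sin (2 * Real.pi * θ) • b₂‖ := norm_add_le _ _
      _ < Mb := by rw [hMb]; linarith
  set M₁ : ℝ := ‖D₀ b₁‖ + ‖D₀ b₂‖ + 1 with hM₁
  have hM₁0 : 0 < M₁ := by positivity
  have hPb : ∀ θ, ‖D₀ (u θ)‖ < M₁ := fun θ => by
    simp only [hu, map_add, map_smul]
    have h1 := norm_smul_le_of_abs_le_one (Real.abs_cos_le_one (2 * Real.pi * θ)) (D₀ b₁)
    have h2 := norm_smul_le_of_abs_le_one (Real.abs_sin_le_one (2 * Real.pi * θ)) (D₀ b₂)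
    calc _ ≤ ‖Real.cos (2 * Real.pi * θ) • D₀ b₁‖ + ‖Real.sin (2 * Real.pi * θ) • D₀ b₂‖ := norm_add_le _ _
      _ < M₁ := by rw [hM₁]; linarith
  set m₀ : ℝ := min ((D₀ b₁) 1 ^ 2 + (D₀ b₁) 2 ^ 2 - (D₀ b₁) 3 ^ 2) ((D₀ b₂) 1 ^ 2 + (D₀ b₂) 2 ^ 2 - (D₀ b₂) 3 ^ 2)
    with hm₀
  have hm₀0 : 0 < m₀ := lt_min hb₁ hb₂
  have hQP : ∀ θ, m₀ ≤ Q (D₀ (u θ)) := fun θ => by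
    have hc := Real.cos_sq_add_sin_sq (2 * Real.pi * θ)
    have e : Q (D₀ (u θ)) = Real.cos (2 * Real.pi * θ) ^ 2 * ((D₀ b₁) 1 ^ 2 + (D₀ b₁) 2 ^ 2 - (D₀ b₁) 3 ^ 2) +
        Real.sin (2 * Real.pi * θ) ^ 2 * ((D₀ b₂) 1 ^ 2 + (D₀ b₂) 2 ^ 2 - (D₀ b₂) 3 ^ 2) := by
      simp only [hQ, hu, map_add, map_smul, PiLp.add_apply, PiLp.smul_apply, smul_eq_mul]
      linear_combination (2 * Real.cos (2 * Real.pi * θ) * Real.sin (2 * Real.pi * θ)) * hb₁₂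
    rw [e]
    nlinarith [min_le_left ((D₀ b₁) 1 ^ 2 + (D₀ b₁) 2 ^ 2 - (D₀ b₁) 3 ^ 2) ((D₀ b₂) 1 ^ 2 + (D₀ b₂) 2 ^ 2 - (D₀ b₂) 3 ^ 2),
      min_le_right ((D₀ b₁) 1 ^ 2 + (D₀ b₁) 2 ^ 2 - (D₀ b₁) 3 ^ 2) ((D₀ b₂) 1 ^ 2 + (D₀ b₂) 2 ^ 2 - (D₀ b₂) 3 ^ 2),
      sq_nonneg (Real.cos (2 * Real.pi * θ)), sq_nonneg (Real.sin (2 * Real.pi * θ))]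
  have hQscale : ∀ (r : ℝ) (a : EuclideanSpace ℝ (Fin 4)), Q (r • a) = r ^ 2 * Q a := fun r a => by
    simp only [hQ, PiLp.smul_apply, smul_eq_mul]; ring
  set c : ℝ := min 1 (m₀ / (2 * ((6 * M₁ + 3 * Mb) * Mb))) with hcdef
  have hc0 : 0 < c := lt_min one_pos (by positivity)
  have hc1 : c ≤ 1 := min_le_left _ _
  have hcm : (6 * M₁ + 3 * Mb) * Mb * c ≤ m₀ / 2 := by
    have : c ≤ m₀ / (2 * ((6 * M₁ + 3 * Mb) * Mb)) := min_le_right _ _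
    rw [le_div_iff₀ (by positivity)] at this
    linarith
  obtain ⟨η, hη, hlinη⟩ := hlin c hc0
  set r₀ : ℝ := min (η / Mb) (δ / (2 * (M₁ + Mb))) with hr₀def
  have hr₀ : 0 < r₀ := lt_min (by positivity) (by positivity)
  set pC : ℂ := ((D₀ b₁) 1 : ℂ) + ((D₀ b₁) 2 : ℂ) * Complex.I with hpC
  set qC : ℂ := ((D₀ b₂) 1 : ℂ) + ((D₀ b₂) 2 : ℂ) * Complex.I with hqC
  have hP12 : ∀ θ, 0 < (D₀ (u θ)) 1 ^ 2 + (D₀ (u θ)) 2 ^ 2 := fun θ => by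
    have := hQP θ; simp only [hQ] at this; nlinarith [sq_nonneg ((D₀ (u θ)) 3)]
  have hdet : pC.re * qC.im - pC.im * qC.re ≠ 0 := by
    intro h0
    obtain ⟨α, hα⟩ := exists_cos_sin_combo_eq_zero h0
    have h := hP12 (α / (2 * Real.pi))
    have hθ : 2 * Real.pi * (α / (2 * Real.pi)) = α := by field_simp
    have hre := congrArg Complex.re hα
    have him := congrArg Complex.im hα
    simp only [hpC, hqC, add_re, mul_re, ofReal_re, ofReal_im, I_re, I_im, mul_zero, sub_zero, zero_mul,
      add_zero, zero_re, add_im, mul_im, zero_add, zero_im, mul_one] at hre him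
    have e1 : (D₀ (u (α / (2 * Real.pi)))) 1 = Real.cos α * (D₀ b₁) 1 + Real.sin α * (D₀ b₂) 1 := by
      simp [hu, hθ]
    have e2 : (D₀ (u (α / (2 * Real.pi)))) 2 = Real.cos α * (D₀ b₁) 2 + Real.sin α * (D₀ b₂) 2 := by
      simp [hu, hθ]
    rw [e1, e2] at h
    nlinarith [hre, him]
  obtain ⟨ε, E, hε, hEc, hE0, hEp, hEstart, hEend⟩ := helper_timelike_ellipseLoop pC qC hdet
  obtain ⟨k, hkc, hk0, -, -, hk1, hkQ, hk12, hkball, -⟩ :=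
    helper_timelike_coneRetraction (δ / 2) δ (by positivity) (by linarith)
  refine ⟨ε, r₀, hε, hr₀, fun r hr hrr₀ => ?_⟩
  have hrη : ∀ θ, ‖r • u θ‖ < η := fun θ => by
    rw [norm_smul, Real.norm_eq_abs, abs_of_pos hr]
    have h1 : r * ‖u θ‖ < r * Mb := mul_lt_mul_of_pos_left (hub θ) hr
    have h2 : r * Mb ≤ η := by
      have := hrr₀.trans (min_le_left _ _)
      rwa [le_div_iff₀ hMb0] at this
    linarith
  have hrδ : r * (M₁ + Mb) < δ := by
    have := hrr₀.trans (min_le_right _ _)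
    rw [le_div_iff₀ (by positivity)] at this
    linarith [mul_pos hr (by positivity : (0:ℝ) < M₁ + Mb)]
  set Er : ℝ → EuclideanSpace ℝ (Fin 4) := fun θ => φ (Wsl (r • u θ)) - r • D₀ (u θ) with hEr
  have hErb : ∀ θ, ‖Er θ‖ ≤ c * r * Mb := fun θ => by
    have h := (hlinη (r • u θ) (hrη θ)).2
    rw [map_smul] at h
    refine h.trans ?_
    rw [norm_smul, Real.norm_eq_abs, abs_of_pos hr, mul_assoc]
    exact mul_le_mul_of_nonneg_left ((mul_le_mul_of_nonneg_left (hub θ).le hr.le)) hc0.le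
  have hsrc : ∀ θ, Wsl (r • u θ) ∈ φ.source := fun θ => (hlinη (r • u θ) (hrη θ)).1
  have hseg : ∀ (θ τ : ℝ), 0 ≤ τ → τ ≤ 1 →
      ‖r • D₀ (u θ) + (1 - τ) • Er θ‖ < δ ∧ 0 < Q (r • D₀ (u θ) + (1 - τ) • Er θ) := by
    intro θ τ h0 h1
    have hEτ : ‖(1 - τ) • Er θ‖ ≤ c * r * Mb := by
      rw [norm_smul, Real.norm_eq_abs, abs_of_nonneg (by linarith)]
      exact (mul_le_of_le_one_left (norm_nonneg _) (by linarith)).trans (hErb θ)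
    have hA : ‖r • D₀ (u θ)‖ ≤ r * M₁ := by
      rw [norm_smul, Real.norm_eq_abs, abs_of_pos hr]; exact mul_le_mul_of_nonneg_left (hPb θ).le hr.le
    constructor
    · calc _ ≤ ‖r • D₀ (u θ)‖ + ‖(1 - τ) • Er θ‖ := norm_add_le _ _
        _ ≤ r * M₁ + c * r * Mb := add_le_add hA hEτ
        _ ≤ r * (M₁ + Mb) := by nlinarith [mul_le_mul_of_nonneg_right hc1 (by positivity : 0 ≤ r * Mb)]
        _ < δ := hrδ
    · have hinc := hQinc (r • D₀ (u θ)) ((1 - τ) • Er θ)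
      have hQ0 : r ^ 2 * m₀ ≤ Q (r • D₀ (u θ)) := by rw [hQscale]; exact mul_le_mul_of_nonneg_left (hQP θ) (sq_nonneg r)
      have hbound : (6 * ‖r • D₀ (u θ)‖ + 3 * ‖(1 - τ) • Er θ‖) * ‖(1 - τ) • Er θ‖ ≤ r ^ 2 * (m₀ / 2) := by
        have h6 : 6 * ‖r • D₀ (u θ)‖ + 3 * ‖(1 - τ) • Er θ‖ ≤ r * (6 * M₁ + 3 * Mb) := by
          have : c * r * Mb ≤ r * Mb := by nlinarith [mul_le_mul_of_nonneg_right hc1 (by positivity : 0 ≤ r * Mb)]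
          nlinarith [hA, hEτ]
        calc _ ≤ r * (6 * M₁ + 3 * Mb) * (c * r * Mb) :=
              mul_le_mul h6 hEτ (norm_nonneg _) (by positivity)
          _ = r ^ 2 * ((6 * M₁ + 3 * Mb) * Mb * c) := by ring
          _ ≤ r ^ 2 * (m₀ / 2) := mul_le_mul_of_nonneg_left hcm (sq_nonneg r)
      have hr2 : 0 < r ^ 2 * (m₀ / 2) := by positivity
      have := abs_le.1 hinc
      linarith [this.1]
  have hmemS : ∀ z : EuclideanSpace ℝ (Fin 4), ‖z‖ < δ → 0 < Q z → φ.symm z ∈ S ∧ φ.symm z ∈ φ.source := fun z hz hQz => by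
    have hzt : z ∈ φ.target := hball (mem_ball_zero_iff.2 hz)
    have hsrc' : φ.symm z ∈ φ.source := φ.map_target hzt
    refine ⟨(hS _ hsrc' (by rw [φ.right_inv hzt]; exact hz)).2 ?_, hsrc'⟩
    rw [φ.right_inv hzt]; exact hQz
  have hβpt : ∀ θ, r • D₀ (u θ) + Er θ = φ (Wsl (r • u θ)) := fun θ => by
    simp only [hEr]; abel
  have hβmem : ∀ θ, Wsl (r • u θ) ∈ S ∧ Wsl (r • u θ) ∈ φ.source ∧ ‖φ (Wsl (r • u θ))‖ < δ := fun θ => by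
    have h := hseg θ 0 le_rfl zero_le_one
    simp only [sub_zero, one_smul] at h
    rw [hβpt θ] at h
    exact ⟨(hS _ (hsrc θ) h.1).2 h.2, hsrc θ, h.1⟩
  refine ⟨fun θ => hβmem θ, fun xβ β hβ xc γc hγc => ?_⟩
  have hφsc : ContinuousOn φ.symm φ.target := φ.continuousOn_symm
  set σ : ℝ → ℝ := fun s => max 0 (min 1 s) with hσ
  have hσc : Continuous σ := continuous_const.max (continuous_const.min continuous_id)
  have hσ01 : ∀ s, 0 ≤ σ s ∧ σ s ≤ 1 := fun s => ⟨le_max_left _ _, max_le zero_le_one (min_le_left _ _)⟩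
  have mkLoop : ∀ (F : ℝ → ↥S), Continuous F → F 1 = F 0 →
      ∃ P : Path (F 0) (F 0), ∀ τ : unitInterval, P τ = F τ := fun F hF h1 =>
    ⟨{ toFun := fun τ => F τ
       continuous_toFun := hF.comp continuous_subtype_val
       source' := by simp
       target' := by simpa using h1 }, fun τ => rfl⟩
  set zA : ℝ × ℝ → EuclideanSpace ℝ (Fin 4) := fun x => r • D₀ (u x.2) + (1 - σ x.1) • Er x.2 with hzA
  have hErc : Continuous Er := by
    simp only [hEr]
    refine Continuous.sub ?_ ((D₀.continuous.comp huc).const_smul r)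
    exact φ.continuousOn.comp_continuous (hWsl.comp (huc.const_smul r)) hsrc
  have hzAc : Continuous zA :=
    ((D₀.continuous.comp (huc.comp continuous_snd)).const_smul r).add
      ((continuous_const.sub (hσc.comp continuous_fst)).smul (hErc.comp continuous_snd))
  have hzAok : ∀ x : ℝ × ℝ, ‖zA x‖ < δ ∧ 0 < Q (zA x) := fun x => hseg x.2 (σ x.1) (hσ01 x.1).1 (hσ01 x.1).2
  set FA : ℝ × ℝ → ↥S := fun x => ⟨φ.symm (zA x), (hmemS _ (hzAok x).1 (hzAok x).2).1⟩ with hFA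
  have hFAc : Continuous FA :=
    (hφsc.comp_continuous hzAc fun x => hball (mem_ball_zero_iff.2 (hzAok x).1)).subtype_mk _
  have hFAp : ∀ s θ, FA (s, θ + 1) = FA (s, θ) := fun s θ => by
    apply Subtype.ext
    simp only [hFA, hzA, hEr, hu1]
  have hσ0 : σ 0 = 0 := by simp [hσ]
  have hσ1 : σ 1 = 1 := by simp [hσ]
  have hFA0 : ∀ θ, ((FA (0, θ) : ↥S) : X) = Wsl (r • u θ) := fun θ => by
    change φ.symm (zA (0, θ)) = _
    have : zA (0, θ) = φ (Wsl (r • u θ)) := by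
      simp only [hzA, hσ0, hEr, sub_zero, one_smul]; abel
    rw [this, φ.left_inv (hsrc θ)]
  have hFA1 : ∀ θ, ((FA (1, θ) : ↥S) : X) = φ.symm (r • D₀ (u θ)) := fun θ => by
    change φ.symm (zA (1, θ)) = _
    simp only [hzA, hσ1, sub_self, zero_smul, add_zero]
  have hp12 : ∀ θ, 0 < (r • D₀ (u θ)) 1 ^ 2 + (r • D₀ (u θ)) 2 ^ 2 := fun θ => by
    simp only [PiLp.smul_apply, smul_eq_mul]
    have := hP12 θ
    nlinarith [mul_pos (pow_pos hr 2) this]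
  have hpok : ∀ θ, ‖r • D₀ (u θ)‖ < δ ∧ 0 < Q (r • D₀ (u θ)) := fun θ => by
    have := hseg θ 1 zero_le_one le_rfl
    simpa using this
  set FB : ℝ × ℝ → ↥S := fun x => ⟨φ.symm (k x.1 (r • D₀ (u x.2))),
    (hmemS _ (hkball x.1 _ (hp12 x.2) (hpok x.2).1) (hkQ x.1 _ (hpok x.2).2)).1⟩ with hFB
  have hFBc : Continuous FB := by
    have h1 : Continuous fun x : ℝ × ℝ => k x.1 (r • D₀ (u x.2)) :=
      hkc.comp_continuous (continuous_fst.prodMk ((D₀.continuous.comp (huc.comp continuous_snd)).const_smul r))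
        fun x => ⟨mem_univ _, hp12 x.2⟩
    exact (hφsc.comp_continuous h1 fun x => hball (mem_ball_zero_iff.2
      (hkball x.1 _ (hp12 x.2) (hpok x.2).1))).subtype_mk _
  have hFBp : ∀ s θ, FB (s, θ + 1) = FB (s, θ) := fun s θ => by
    apply Subtype.ext; simp only [hFB, hu1]
  have hFB0 : ∀ θ, ((FB (0, θ) : ↥S) : X) = φ.symm (r • D₀ (u θ)) := fun θ => by
    change φ.symm (k 0 (r • D₀ (u θ))) = _; rw [hk0]
  set vecE : ℝ × ℝ → EuclideanSpace ℝ (Fin 4) := fun x =>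
    WithLp.toLp 2 ![0, δ / 2 * (E x).re / ‖E x‖, δ / 2 * (E x).im / ‖E x‖, 0] with hvecE
  have hvec0 : ∀ x, vecE x 0 = 0 := fun x => by simp [hvecE]
  have hvec1 : ∀ x, vecE x 1 = δ / 2 * (E x).re / ‖E x‖ := fun x => by simp [hvecE]
  have hvec2 : ∀ x, vecE x 2 = δ / 2 * (E x).im / ‖E x‖ := fun x => by simp [hvecE]
  have hvec3 : ∀ x, vecE x 3 = 0 := fun x => by simp [hvecE]
  have hEn : ∀ x, (E x).re ^ 2 + (E x).im ^ 2 = ‖E x‖ ^ 2 := fun x => by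
    rw [Complex.sq_norm, Complex.normSq_apply]; ring
  have hEn0 : ∀ x, 0 < ‖E x‖ := fun x => norm_pos_iff.2 (hE0 x.1 x.2)
  have hsum : ∀ x, (δ / 2 * (E x).re / ‖E x‖) ^ 2 + (δ / 2 * (E x).im / ‖E x‖) ^ 2 = (δ / 2) ^ 2 :=
    fun x => by
      have hn0 : ‖E x‖ ≠ 0 := (hEn0 x).ne'
      have e : (δ / 2 * (E x).re / ‖E x‖) ^ 2 + (δ / 2 * (E x).im / ‖E x‖) ^ 2 =
          (δ / 2) ^ 2 * (((E x).re ^ 2 + (E x).im ^ 2) / ‖E x‖ ^ 2) := by ring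
      rw [e, hEn, div_self (pow_ne_zero 2 hn0), mul_one]
  have hvecQ : ∀ x, Q (vecE x) = (δ / 2) ^ 2 := fun x => by
    simp only [hQ, hvec1, hvec2, hvec3]
    rw [← hsum x]; ring
  have hvecn : ∀ x, ‖vecE x‖ = δ / 2 := fun x => by
    rw [EuclideanSpace.norm_eq, Fin.sum_univ_four]
    simp only [Real.norm_eq_abs, sq_abs, hvec0, hvec1, hvec2, hvec3]
    rw [show (0 : ℝ) ^ 2 + (δ / 2 * (E x).re / ‖E x‖) ^ 2 + (δ / 2 * (E x).im / ‖E x‖) ^ 2 + (0 : ℝ) ^ 2 =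
      (δ / 2) ^ 2 by rw [← hsum x]; ring]
    exact Real.sqrt_sq (by positivity)
  have hvecok : ∀ x, ‖vecE x‖ < δ ∧ 0 < Q (vecE x) := fun x =>
    ⟨by rw [hvecn]; linarith, by rw [hvecQ]; positivity⟩
  set FC : ℝ × ℝ → ↥S := fun x => ⟨φ.symm (vecE x), (hmemS _ (hvecok x).1 (hvecok x).2).1⟩ with hFC
  have hvecc : Continuous vecE := by
    have hn : Continuous fun x : ℝ × ℝ => ‖E x‖ := hEc.norm
    have h1 : Continuous fun x : ℝ × ℝ => δ / 2 * (E x).re / ‖E x‖ :=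
      (continuous_const.mul (Complex.continuous_re.comp hEc)).div hn fun x => (hEn0 x).ne'
    have h2 : Continuous fun x : ℝ × ℝ => δ / 2 * (E x).im / ‖E x‖ :=
      (continuous_const.mul (Complex.continuous_im.comp hEc)).div hn fun x => (hEn0 x).ne'
    simp only [hvecE]
    refine (PiLp.continuous_toLp 2 _).comp (continuous_pi fun i => ?_)
    fin_cases i
    · simpa using continuous_const
    · simpa using h1
    · simpa using h2
    · simpa using continuous_const
  have hFCc : Continuous FC :=
    (hφsc.comp_continuous hvecc fun x => hball (mem_ball_zero_iff.2 (hvecok x).1)).subtype_mk _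
  have hFCp : ∀ s θ, FC (s, θ + 1) = FC (s, θ) := fun s θ => by
    apply Subtype.ext; simp only [hFC, hvecE, hEp]
  have hP1 : ∀ θ, (D₀ (u θ)) 1 = (E (0, θ)).re ∧ (D₀ (u θ)) 2 = (E (0, θ)).im := fun θ => by
    rw [hEstart]
    simp only [hpC, hqC, hu, map_add, map_smul, PiLp.add_apply, PiLp.smul_apply, smul_eq_mul, add_re,
      add_im, mul_re, mul_im, ofReal_re, ofReal_im,
      Complex.I_re, Complex.I_im, mul_zero, mul_one, sub_zero, zero_add, add_zero]
    constructor <;> ring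
  have hBC : ∀ θ, ((FB (1, θ) : ↥S) : X) = ((FC (0, θ) : ↥S) : X) := fun θ => by
    change φ.symm (k 1 (r • D₀ (u θ))) = φ.symm (vecE (0, θ))
    congr 1
    obtain ⟨h0, h1, h2, h3⟩ := hk1 _ (hp12 θ)
    obtain ⟨e1, e2⟩ := hP1 θ
    have hn : Real.sqrt ((r • D₀ (u θ)) 1 ^ 2 + (r • D₀ (u θ)) 2 ^ 2) = r * ‖E (0, θ)‖ := by
      simp only [PiLp.smul_apply, smul_eq_mul, e1, e2]
      rw [show (r * (E (0, θ)).re) ^ 2 + (r * (E (0, θ)).im) ^ 2 = (r * ‖E (0, θ)‖) ^ 2 by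
        rw [mul_pow, mul_pow, mul_pow, ← hEn]; ring]
      exact Real.sqrt_sq (by positivity)
    ext i
    fin_cases i
    · simpa [hvec0] using h0
    · simp only [Fin.mk_one]
      rw [h1, hvec1, hn]
      simp only [PiLp.smul_apply, smul_eq_mul, e1]
      field_simp
    · simp only [Fin.reduceFinMk]
      rw [h2, hvec2, hn]
      simp only [PiLp.smul_apply, smul_eq_mul, e2]
      field_simp
    · simpa [hvec3] using h3
  have hC1 : ∀ θ, ((FC (1, θ) : ↥S) : X) =
      φ.symm (WithLp.toLp 2 ![0, δ / 2 * Real.cos (2 * Real.pi * ε * θ), δ / 2 * Real.sin (2 * Real.pi * ε * θ), 0]) :=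
    fun θ => by
      change φ.symm (vecE (1, θ)) = _
      congr 1
      have hex : E (1, θ) = Complex.exp (((2 * Real.pi * ε * θ : ℝ) : ℂ) * Complex.I) := by
        rw [hEend]; push_cast; ring_nf
      have hre : (E (1, θ)).re = Real.cos (2 * Real.pi * ε * θ) := by
        rw [hex, Complex.exp_ofReal_mul_I_re]
      have him : (E (1, θ)).im = Real.sin (2 * Real.pi * ε * θ) := by
        rw [hex, Complex.exp_ofReal_mul_I_im]
      have hnorm : ‖E (1, θ)‖ = 1 := by rw [hex, Complex.norm_exp_ofReal_mul_I]
      simp only [hvecE, hre, him, hnorm, div_one]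
  obtain ⟨P₁, hP₁⟩ := mkLoop (fun θ => FA (1, θ)) (hFAc.comp (continuous_const.prodMk continuous_id))
    (by have := hFAp 1 0; rwa [zero_add] at this)
  obtain ⟨P₂, hP₂⟩ := mkLoop (fun θ => FB (1, θ)) (hFBc.comp (continuous_const.prodMk continuous_id))
    (by have := hFBp 1 0; rwa [zero_add] at this)
  have e1 : loopClass ℤ ℤ (1 : ℤ) β = loopClass ℤ ℤ (1 : ℤ) P₁ :=
    loopClass_eq_of_freeHomotopy hFAc hFAp β P₁ (fun τ => Subtype.ext (by rw [hβ τ, hFA0])) hP₁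
  have e2 : loopClass ℤ ℤ (1 : ℤ) P₁ = loopClass ℤ ℤ (1 : ℤ) P₂ :=
    loopClass_eq_of_freeHomotopy hFBc hFBp P₁ P₂ (fun τ => by rw [hP₁]; exact Subtype.ext (by rw [hFA1, hFB0])) hP₂
  have e3 : loopClass ℤ ℤ (1 : ℤ) P₂ = loopClass ℤ ℤ (1 : ℤ) γc :=
    loopClass_eq_of_freeHomotopy hFCc hFCp P₂ γc (fun τ => by rw [hP₂]; exact Subtype.ext (hBC τ))
      (fun τ => Subtype.ext (by rw [hγc τ, hC1]))
  rw [e1, e2, e3]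

end Summit.SmoothPoincare4.SmoothPoincare4.Cruxes.RungOne.Sketch

end
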